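import Summits.HodgeConjecture.CorCM.Census.QuarticInversionLatticeBasis
import Summits.HodgeConjecture.CorCM.Census.QuarticInversionGenerators
import Summits.HodgeConjecture.CorCM.Census.QuarticInversionTrees

/-!
# The quartic inversion twists, XX: the closing lattice — the finite check and the conclusion

COR-CM (cell `pub-hodgecm2`, stage 2 of the Hodge ladder), count-neutral KERNEL COMBINATORICS by the binder seat b23 (gen 44; claim
QUARTIC-INVERSION, HOME/INBOX.md l.12829).  Part XX of the lane `Census/QuarticInversion*`, on top of parts I–XIX, all BY NAME.  Bookkeeping
definitions with bodies (`ΨL`, the integer tables `Gk0/1`, `GCv0/1`, `mu0/1`) + theorems; `decide` only on closed identities between literal integer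
tables over `Fin 4`, `Fin 8`, `Fin 12`, `Fin 16` and on closed values at literal patterns (the finite index-one check of the closing lattice; the
tables were produced by this folder's `work/gen/l8.py` and are re-checked here by the kernel), no certificate, no named fact, no geometry, no
`sorry`.  `Interfaces.lean` (C1), every E term, B01, `Transposition/*`, `PortJoin/*` untouched.
HONEST FRAMING: `HC_CM` is NOT proved, here or anywhere in the tree; nothing here is a period, a count of record or a headline.

CONTENT (`|B|` odd `≥ 3`, square class `ζ`, a slot datum `(P,u₁,u₂;Q,w,u₀)` and a cross datum `(σ,s₀)` as in part XVII).
* §3 **The finite check**: for `ζ = 0` and `ζ = 1`, every basis vector `B_l` of the relation lattice (part XIX) is an explicit integer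
  combination of the tables of the twelve normal forms of `g·S_b` (`g ∈ {e, y, t, ty}`, `b ∈ {TTT, TTF, TFT}`; `B_eq_sum_G0/1`), and these
  tables ARE the normal forms of part XVIII (`ΦL_G0_mem`, `ΦL_G1_mem`: so they lie in the value module of `B1`).
* §4 **CONCLUSION**: for every Hodge vector `x`, `nf x` and hence `Avec x` lie in the value module of `B1` (`nf_mem_valMod_of_hodge`,
  `Avec_mem_valMod_of_hodge`): every value of every functional on `x` is realised inside the orbit span of the ten closing faces.  All [folklore].

## References
* [Pohlmann1968] H. Pohlmann, Algebraic cycles on abelian varieties of complex multiplication type, Ann. of Math. 88 (1968), Thm 1.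
-/

namespace Summit.HodgeConjecture.CorCM.Census.QuarticInversion

open Finset
open Summit.HodgeConjecture.CorCM.Census.OddSliceFacesModel

noncomputable section

section Psi
variable (A : Type) [AddCommGroup A] [Fintype A] [DecidableEq A]

/-- **`ΨL (k, v) = Φ k (tab16 v)`**, linear in the table. [folklore] -/
def ΨL : ((Fin 4 → ℤ) × (Fin 16 → ℤ)) →ₗ[ℤ] (Idx A → ℤ) where
  toFun p := Φ A p.1 (tab16 p.2)
  map_add' p q := by
    rw [Prod.fst_add, Prod.snd_add, ← Φ_add]; rfl
  map_smul' c p := by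
    rw [Prod.smul_fst, Prod.smul_snd, RingHom.id_apply, ← Φ_smul]; rfl

omit [AddCommGroup A] [Fintype A] [DecidableEq A] in
/-- `ΨL (k, v) = ΦL (k, tab16 v)`. [folklore] -/
theorem ΨL_apply (k : Fin 4 → ℤ) (v : Fin 16 → ℤ) : ΨL A (k, v) = ΦL A (k, tab16 v) := rfl

end Psi

/-! ## §3 The generator tables and the finite check -/

/-- The column parts of the twelve generator normal forms, `ζ = 0` (order `b ∈ (TTT, TTF, TFT)` × `(e, y, t, ty)`). [folklore] -/
def Gk0 : Fin 12 → Fin 4 → ℤ := ![![1, 0, 0, 0], ![0, 1, 0, 0], ![0, 0, -1, 0], ![0, 0, 0, 1], ![1, 0, 0, 0], ![0, 1, 0, 0], ![0, 0, -1, 0], ![0, 0, 0, 1], ![1, 0, 0, 0], ![0, 1, 0, 0], ![0, 0, -1, 0], ![0, 0, 0, 1]]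

/-- The constant parts (as tables) of the twelve generator normal forms, `ζ = 0`. [folklore] -/
def GCv0 : Fin 12 → Fin 16 → ℤ := ![![1, 0, 0, 0, 0, 0, 0, 1, -1, 0, 0, 0, 0, 0, 0, -1],
  ![1, 0, 0, 0, -1, 0, 0, 0, 0, 0, 0, 1, 0, 0, 0, -1],
  ![0, 0, 0, 0, -1, 0, 1, 0, 0, -1, 0, 1, 0, 0, 0, 0],
  ![0, 0, 0, 0, 0, 0, 1, -1, 1, -1, 0, 0, 0, 0, 0, 0],
  ![0, 1, 0, 0, 0, 0, 1, 0, 0, -1, 0, 0, 0, 0, -1, 0],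
  ![0, 0, 1, 0, 0, 0, -1, 0, 0, 1, 0, 0, 0, -1, 0, 0],
  ![-1, 0, 1, 0, 0, 0, 0, 0, 0, 0, 0, 0, 0, -1, 0, 1],
  ![1, -1, 0, 0, 0, 0, 0, 0, 0, 0, 0, 0, 0, 0, 1, -1],
  ![0, 0, 1, 0, 0, 1, 0, 0, 0, 0, -1, 0, 0, -1, 0, 0],
  ![0, 1, 0, 0, 0, -1, 0, 0, 0, 0, 1, 0, 0, 0, -1, 0],
  ![0, -1, 0, 1, 0, 0, 0, 0, 0, 0, 0, 0, -1, 0, 1, 0],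
  ![0, 0, 1, -1, 0, 0, 0, 0, 0, 0, 0, 0, 1, -1, 0, 0]]

/-- The integer coefficients expressing the basis vectors through the generators, `ζ = 0`. [folklore] -/
def mu0 : Fin 8 → Fin 12 → ℤ := ![![-1, 1, -1, 0, 1, -1, 0, 0, 1, 0, 1, 0],
  ![-1, 1, -1, 0, 1, 0, 0, 0, 0, 0, 1, 0],
  ![-1, 1, -1, 0, 0, -1, 0, 0, 1, 0, 0, 0],
  ![0, 0, 0, 1, 0, 0, 0, 0, 0, 0, 0, 0],
  ![-2, 1, -1, 0, 1, -1, 0, 0, 1, 0, 1, 0],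
  ![-1, 1, -1, 0, 0, -1, 0, 0, 1, 0, 1, 0],
  ![-1, 1, -1, 0, 1, -1, 0, 0, 0, 0, 1, 0],
  ![-1, 1, 0, 0, 0, -1, 0, 0, 1, 0, 0, 0]]

/-- The column parts of the twelve generator normal forms, `ζ = 1` (order `b ∈ (TTT, TTF, TFT)` × `(e, y, t, ty)`). [folklore] -/
def Gk1 : Fin 12 → Fin 4 → ℤ := ![![1, 0, 0, 0], ![0, -1, 0, 0], ![0, 0, -1, 0], ![0, 0, 0, -1], ![1, 0, 0, 0], ![0, -1, 0, 0], ![0, 0, -1, 0], ![0, 0, 0, -1], ![1, 0, 0, 0], ![0, -1, 0, 0], ![0, 0, -1, 0], ![0, 0, 0, -1]]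

/-- The constant parts (as tables) of the twelve generator normal forms, `ζ = 1`. [folklore] -/
def GCv1 : Fin 12 → Fin 16 → ℤ := ![![1, 0, 0, 0, 0, 0, 0, 1, -1, 0, 0, 0, 0, 0, 0, -1],
  ![0, -1, 0, 0, 0, 1, 0, 0, 0, 0, -1, 0, 0, 0, 1, 0],
  ![0, 0, 0, 0, -1, 0, 1, 0, 0, -1, 0, 1, 0, 0, 0, 0],
  ![0, 0, -1, 1, 0, 0, 0, 0, 0, 0, 0, 0, -1, 1, 0, 0],
  ![0, 1, 0, 0, 0, 0, 1, 0, 0, -1, 0, 0, 0, 0, -1, 0],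
  ![0, 0, 0, -1, 0, 0, 0, 1, -1, 0, 0, 0, 1, 0, 0, 0],
  ![-1, 0, 1, 0, 0, 0, 0, 0, 0, 0, 0, 0, 0, -1, 0, 1],
  ![0, 0, 0, 0, -1, 1, 0, 0, 0, 0, -1, 1, 0, 0, 0, 0],
  ![0, 0, 1, 0, 0, 1, 0, 0, 0, 0, -1, 0, 0, -1, 0, 0],
  ![-1, 0, 0, 0, 1, 0, 0, 0, 0, 0, 0, -1, 0, 0, 0, 1],
  ![0, -1, 0, 1, 0, 0, 0, 0, 0, 0, 0, 0, -1, 0, 1, 0],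
  ![0, 0, 0, 0, 0, 0, -1, 1, -1, 1, 0, 0, 0, 0, 0, 0]]

/-- The integer coefficients expressing the basis vectors through the generators, `ζ = 1`. [folklore] -/
def mu1 : Fin 8 → Fin 12 → ℤ := ![![0, 1, 0, 0, 1, -1, 0, 0, 0, 0, 0, 0],
  ![0, 0, 0, 0, 0, -1, 0, 0, 0, 0, 0, 0],
  ![-1, 0, 0, 0, 0, 0, -1, 0, 1, 0, 0, 0],
  ![0, 1, 0, -1, 1, -1, 0, 0, -1, 0, 0, 0],
  ![-1, 1, 0, 0, 1, -1, 0, 0, 0, 0, 0, 0],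
  ![0, 1, 0, 0, 0, -1, 0, 0, 0, 0, 0, 0],
  ![0, 1, 0, 0, 1, -1, 0, 0, -1, 0, 0, 0],
  ![-1, 0, 1, 0, 0, 0, -1, 0, 1, 0, 0, 0]]

/-- **The finite check, `ζ = 0`**: every basis vector of the relation lattice is an integer combination of the generator normal forms. [folklore] -/
theorem B_eq_sum_G0 (l : Fin 8) : ((Bk l, BCv l) : (Fin 4 → ℤ) × (Fin 16 → ℤ)) =
    ∑ i : Fin 12, mu0 l i • (Gk0 i, GCv0 i) := by
  fin_cases l <;> decide

/-- **The finite check, `ζ = 1`**: every basis vector of the relation lattice is an integer combination of the generator normal forms. [folklore] -/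
theorem B_eq_sum_G1 (l : Fin 8) : ((Bk l, BCv l) : (Fin 4 → ℤ) × (Fin 16 → ℤ)) =
    ∑ i : Fin 12, mu1 l i • (Gk1 i, GCv1 i) := by
  fin_cases l <;> decide

section Members
variable (A : Type) [AddCommGroup A] [Fintype A] [DecidableEq A]
variable {P : Finset A} {u₁ u₂ : A} {Q : Finset A} {w u₀ σ s₀ : A}

omit [AddCommGroup A] in
/-- `B1` consists of Hodge vectors. [folklore] -/
theorem famB1_subset_hodge₄ (h12 : u₁ ≠ u₂) : (↑(famB1 A P u₁ u₂ Q w u₀) : Set (Ty₄ A → ℤ)) ⊆ hodge₄ A := by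
  intro f hf
  obtain ⟨k, -, rfl⟩ := Finset.mem_image.mp (Finset.mem_coe.mp hf)
  have hne : ((0 : Fin 4), u₁) ≠ ((0 : Fin 4), u₂) := fun e => h12 (Prod.mk.inj e).2
  have hne1 : ∀ u u' : A, ((0 : Fin 4), u) ≠ ((1 : Fin 4), u') := fun u u' e => absurd (Prod.mk.inj e).1 (by decide)
  have hne2 : ∀ u u' : A, ((0 : Fin 4), u) ≠ ((2 : Fin 4), u') := fun u u' e => absurd (Prod.mk.inj e).1 (by decide)
  fin_cases k
  · exact faceVec₄_mem A _ hne
  · exact faceVec₄_mem A _ hne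
  · exact faceVec₄_mem A _ hne
  · exact faceVec₄_mem A _ hne
  · exact faceVec₄_mem A _ hne
  · exact faceVec₄_mem A _ (hne1 _ _)
  · exact faceVec₄_mem A _ (hne2 _ _)
  · exact faceVec₄_mem A _ (hne1 _ _)
  · exact faceVec₄_mem A _ (hne1 _ _)
  · exact faceVec₄_mem A _ (hne1 _ _)

/-- **Every generator normal form lies in the value module of `B1`, `ζ = 0`.** [folklore] -/
theorem ΦL_G0_mem (hA : Odd (Fintype.card A)) (h3 : 3 ≤ Fintype.card A) (h1 : u₁ ∉ P) (h2 : u₂ ∉ P) (h12 : u₁ ≠ u₂)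
    (hP : P.card + 1 = Fintype.card A / 2) (hs₀ : s₀ ∈ insert u₁ (insert u₂ P))
    (hX : ∀ s, s + σ ∈ insert u₁ (insert u₂ P) ↔ (s ∉ insert u₁ (insert u₂ P) ∨ s = s₀)) (hw : w ∉ Q)
    (hQ : Q.card = Fintype.card A / 2) (i : Fin 12) :
    ΨL A (Gk0 i, GCv0 i) ∈ valMod A 0 ↑(famB1 A P u₁ u₂ Q w u₀) := by
  have hF := famB1_subset_hodge₄ A (P := P) (Q := Q) (w := w) (u₀ := u₀) h12
  have hbin := all_bin A hA h3 0 h1 h2 h12 hP hs₀ hX hw hQ (u₀ := u₀)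
  have mTTT := subset_orbSpan A 0 _ (mem_S_TTT A P u₁ u₂ Q w u₀)
  have mTTF := subset_orbSpan A 0 _ (mem_S_TTF A P u₁ u₂ Q w u₀)
  have mTFT := subset_orbSpan A 0 _ (mem_S_TFT A P u₁ u₂ Q w u₀)
  fin_cases i
  · show ΨL A (Gk0 0, GCv0 0) ∈ _
    have e : ((Gk0 0, tab16 (GCv0 0)) : (Fin 4 → ℤ) × ((Fin 4 → Bool) → ℤ)) = (kS, cB ![false, true, true, true]) :=
      Prod.ext (by decide) (funext_pat fun a b c d => by cases a <;> cases b <;> cases c <;> cases d <;> decide)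
    have h := nf_mem_of_bin A hA 0 hF hbin mTTT
    rw [nf_S A hA h1 h2 h12 hP ![false, true, true, true]] at h
    rw [ΨL_apply, e]; exact h
  · show ΨL A (Gk0 1, GCv0 1) ∈ _
    have e : ((Gk0 1, tab16 (GCv0 1)) : (Fin 4 → ℤ) × ((Fin 4 → Bool) → ℤ)) = (kY 0, fun η => cB ![false, true, true, true] (pY 0 η)) :=
      Prod.ext (by decide) (funext_pat fun a b c d => by cases a <;> cases b <;> cases c <;> cases d <;> decide)
    have h := nf_mem_of_bin A hA 0 hF hbin (translY_mem_orbSpan A 0 _ mTTT)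
    rw [nf_yS A hA 0 h1 h2 h12 hP ![false, true, true, true]] at h
    rw [ΨL_apply, e]; exact h
  · show ΨL A (Gk0 2, GCv0 2) ∈ _
    have e : ((Gk0 2, tab16 (GCv0 2)) : (Fin 4 → ℤ) × ((Fin 4 → Bool) → ℤ)) = (kT, fun η => cB ![false, true, true, true] (pT η)) :=
      Prod.ext (by decide) (funext_pat fun a b c d => by cases a <;> cases b <;> cases c <;> cases d <;> decide)
    have h := nf_mem_of_bin A hA 0 hF hbin (translT_mem_orbSpan A 0 _ mTTT)
    rw [nf_tS A hA h1 h2 h12 hP ![false, true, true, true]] at h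
    rw [ΨL_apply, e]; exact h
  · show ΨL A (Gk0 3, GCv0 3) ∈ _
    have e : ((Gk0 3, tab16 (GCv0 3)) : (Fin 4 → ℤ) × ((Fin 4 → Bool) → ℤ)) = (kTY 0, fun η => cB ![false, true, true, true] (pY 0 (pT η))) :=
      Prod.ext (by decide) (funext_pat fun a b c d => by cases a <;> cases b <;> cases c <;> cases d <;> decide)
    have h := nf_mem_of_bin A hA 0 hF hbin (translT_mem_orbSpan A 0 _ (translY_mem_orbSpan A 0 _ mTTT))
    rw [nf_tyS A hA 0 h1 h2 h12 hP ![false, true, true, true]] at h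
    rw [ΨL_apply, e]; exact h
  · show ΨL A (Gk0 4, GCv0 4) ∈ _
    have e : ((Gk0 4, tab16 (GCv0 4)) : (Fin 4 → ℤ) × ((Fin 4 → Bool) → ℤ)) = (kS, cB ![false, true, true, false]) :=
      Prod.ext (by decide) (funext_pat fun a b c d => by cases a <;> cases b <;> cases c <;> cases d <;> decide)
    have h := nf_mem_of_bin A hA 0 hF hbin mTTF
    rw [nf_S A hA h1 h2 h12 hP ![false, true, true, false]] at h
    rw [ΨL_apply, e]; exact h
  · show ΨL A (Gk0 5, GCv0 5) ∈ _
    have e : ((Gk0 5, tab16 (GCv0 5)) : (Fin 4 → ℤ) × ((Fin 4 → Bool) → ℤ)) = (kY 0, fun η => cB ![false, true, true, false] (pY 0 η)) :=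
      Prod.ext (by decide) (funext_pat fun a b c d => by cases a <;> cases b <;> cases c <;> cases d <;> decide)
    have h := nf_mem_of_bin A hA 0 hF hbin (translY_mem_orbSpan A 0 _ mTTF)
    rw [nf_yS A hA 0 h1 h2 h12 hP ![false, true, true, false]] at h
    rw [ΨL_apply, e]; exact h
  · show ΨL A (Gk0 6, GCv0 6) ∈ _
    have e : ((Gk0 6, tab16 (GCv0 6)) : (Fin 4 → ℤ) × ((Fin 4 → Bool) → ℤ)) = (kT, fun η => cB ![false, true, true, false] (pT η)) :=
      Prod.ext (by decide) (funext_pat fun a b c d => by cases a <;> cases b <;> cases c <;> cases d <;> decide)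
    have h := nf_mem_of_bin A hA 0 hF hbin (translT_mem_orbSpan A 0 _ mTTF)
    rw [nf_tS A hA h1 h2 h12 hP ![false, true, true, false]] at h
    rw [ΨL_apply, e]; exact h
  · show ΨL A (Gk0 7, GCv0 7) ∈ _
    have e : ((Gk0 7, tab16 (GCv0 7)) : (Fin 4 → ℤ) × ((Fin 4 → Bool) → ℤ)) = (kTY 0, fun η => cB ![false, true, true, false] (pY 0 (pT η))) :=
      Prod.ext (by decide) (funext_pat fun a b c d => by cases a <;> cases b <;> cases c <;> cases d <;> decide)
    have h := nf_mem_of_bin A hA 0 hF hbin (translT_mem_orbSpan A 0 _ (translY_mem_orbSpan A 0 _ mTTF))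
    rw [nf_tyS A hA 0 h1 h2 h12 hP ![false, true, true, false]] at h
    rw [ΨL_apply, e]; exact h
  · show ΨL A (Gk0 8, GCv0 8) ∈ _
    have e : ((Gk0 8, tab16 (GCv0 8)) : (Fin 4 → ℤ) × ((Fin 4 → Bool) → ℤ)) = (kS, cB ![false, true, false, true]) :=
      Prod.ext (by decide) (funext_pat fun a b c d => by cases a <;> cases b <;> cases c <;> cases d <;> decide)
    have h := nf_mem_of_bin A hA 0 hF hbin mTFT
    rw [nf_S A hA h1 h2 h12 hP ![false, true, false, true]] at h
    rw [ΨL_apply, e]; exact h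
  · show ΨL A (Gk0 9, GCv0 9) ∈ _
    have e : ((Gk0 9, tab16 (GCv0 9)) : (Fin 4 → ℤ) × ((Fin 4 → Bool) → ℤ)) = (kY 0, fun η => cB ![false, true, false, true] (pY 0 η)) :=
      Prod.ext (by decide) (funext_pat fun a b c d => by cases a <;> cases b <;> cases c <;> cases d <;> decide)
    have h := nf_mem_of_bin A hA 0 hF hbin (translY_mem_orbSpan A 0 _ mTFT)
    rw [nf_yS A hA 0 h1 h2 h12 hP ![false, true, false, true]] at h
    rw [ΨL_apply, e]; exact h
  · show ΨL A (Gk0 10, GCv0 10) ∈ _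
    have e : ((Gk0 10, tab16 (GCv0 10)) : (Fin 4 → ℤ) × ((Fin 4 → Bool) → ℤ)) = (kT, fun η => cB ![false, true, false, true] (pT η)) :=
      Prod.ext (by decide) (funext_pat fun a b c d => by cases a <;> cases b <;> cases c <;> cases d <;> decide)
    have h := nf_mem_of_bin A hA 0 hF hbin (translT_mem_orbSpan A 0 _ mTFT)
    rw [nf_tS A hA h1 h2 h12 hP ![false, true, false, true]] at h
    rw [ΨL_apply, e]; exact h
  · show ΨL A (Gk0 11, GCv0 11) ∈ _
    have e : ((Gk0 11, tab16 (GCv0 11)) : (Fin 4 → ℤ) × ((Fin 4 → Bool) → ℤ)) = (kTY 0, fun η => cB ![false, true, false, true] (pY 0 (pT η))) :=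
      Prod.ext (by decide) (funext_pat fun a b c d => by cases a <;> cases b <;> cases c <;> cases d <;> decide)
    have h := nf_mem_of_bin A hA 0 hF hbin (translT_mem_orbSpan A 0 _ (translY_mem_orbSpan A 0 _ mTFT))
    rw [nf_tyS A hA 0 h1 h2 h12 hP ![false, true, false, true]] at h
    rw [ΨL_apply, e]; exact h

/-- **Every generator normal form lies in the value module of `B1`, `ζ = 1`.** [folklore] -/
theorem ΦL_G1_mem (hA : Odd (Fintype.card A)) (h3 : 3 ≤ Fintype.card A) (h1 : u₁ ∉ P) (h2 : u₂ ∉ P) (h12 : u₁ ≠ u₂)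
    (hP : P.card + 1 = Fintype.card A / 2) (hs₀ : s₀ ∈ insert u₁ (insert u₂ P))
    (hX : ∀ s, s + σ ∈ insert u₁ (insert u₂ P) ↔ (s ∉ insert u₁ (insert u₂ P) ∨ s = s₀)) (hw : w ∉ Q)
    (hQ : Q.card = Fintype.card A / 2) (i : Fin 12) :
    ΨL A (Gk1 i, GCv1 i) ∈ valMod A 1 ↑(famB1 A P u₁ u₂ Q w u₀) := by
  have hF := famB1_subset_hodge₄ A (P := P) (Q := Q) (w := w) (u₀ := u₀) h12
  have hbin := all_bin A hA h3 1 h1 h2 h12 hP hs₀ hX hw hQ (u₀ := u₀)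
  have mTTT := subset_orbSpan A 1 _ (mem_S_TTT A P u₁ u₂ Q w u₀)
  have mTTF := subset_orbSpan A 1 _ (mem_S_TTF A P u₁ u₂ Q w u₀)
  have mTFT := subset_orbSpan A 1 _ (mem_S_TFT A P u₁ u₂ Q w u₀)
  fin_cases i
  · show ΨL A (Gk1 0, GCv1 0) ∈ _
    have e : ((Gk1 0, tab16 (GCv1 0)) : (Fin 4 → ℤ) × ((Fin 4 → Bool) → ℤ)) = (kS, cB ![false, true, true, true]) :=
      Prod.ext (by decide) (funext_pat fun a b c d => by cases a <;> cases b <;> cases c <;> cases d <;> decide)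
    have h := nf_mem_of_bin A hA 1 hF hbin mTTT
    rw [nf_S A hA h1 h2 h12 hP ![false, true, true, true]] at h
    rw [ΨL_apply, e]; exact h
  · show ΨL A (Gk1 1, GCv1 1) ∈ _
    have e : ((Gk1 1, tab16 (GCv1 1)) : (Fin 4 → ℤ) × ((Fin 4 → Bool) → ℤ)) = (kY 1, fun η => cB ![false, true, true, true] (pY 1 η)) :=
      Prod.ext (by decide) (funext_pat fun a b c d => by cases a <;> cases b <;> cases c <;> cases d <;> decide)
    have h := nf_mem_of_bin A hA 1 hF hbin (translY_mem_orbSpan A 1 _ mTTT)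
    rw [nf_yS A hA 1 h1 h2 h12 hP ![false, true, true, true]] at h
    rw [ΨL_apply, e]; exact h
  · show ΨL A (Gk1 2, GCv1 2) ∈ _
    have e : ((Gk1 2, tab16 (GCv1 2)) : (Fin 4 → ℤ) × ((Fin 4 → Bool) → ℤ)) = (kT, fun η => cB ![false, true, true, true] (pT η)) :=
      Prod.ext (by decide) (funext_pat fun a b c d => by cases a <;> cases b <;> cases c <;> cases d <;> decide)
    have h := nf_mem_of_bin A hA 1 hF hbin (translT_mem_orbSpan A 1 _ mTTT)
    rw [nf_tS A hA h1 h2 h12 hP ![false, true, true, true]] at h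
    rw [ΨL_apply, e]; exact h
  · show ΨL A (Gk1 3, GCv1 3) ∈ _
    have e : ((Gk1 3, tab16 (GCv1 3)) : (Fin 4 → ℤ) × ((Fin 4 → Bool) → ℤ)) = (kTY 1, fun η => cB ![false, true, true, true] (pY 1 (pT η))) :=
      Prod.ext (by decide) (funext_pat fun a b c d => by cases a <;> cases b <;> cases c <;> cases d <;> decide)
    have h := nf_mem_of_bin A hA 1 hF hbin (translT_mem_orbSpan A 1 _ (translY_mem_orbSpan A 1 _ mTTT))
    rw [nf_tyS A hA 1 h1 h2 h12 hP ![false, true, true, true]] at h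
    rw [ΨL_apply, e]; exact h
  · show ΨL A (Gk1 4, GCv1 4) ∈ _
    have e : ((Gk1 4, tab16 (GCv1 4)) : (Fin 4 → ℤ) × ((Fin 4 → Bool) → ℤ)) = (kS, cB ![false, true, true, false]) :=
      Prod.ext (by decide) (funext_pat fun a b c d => by cases a <;> cases b <;> cases c <;> cases d <;> decide)
    have h := nf_mem_of_bin A hA 1 hF hbin mTTF
    rw [nf_S A hA h1 h2 h12 hP ![false, true, true, false]] at h
    rw [ΨL_apply, e]; exact h
  · show ΨL A (Gk1 5, GCv1 5) ∈ _
    have e : ((Gk1 5, tab16 (GCv1 5)) : (Fin 4 → ℤ) × ((Fin 4 → Bool) → ℤ)) = (kY 1, fun η => cB ![false, true, true, false] (pY 1 η)) :=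
      Prod.ext (by decide) (funext_pat fun a b c d => by cases a <;> cases b <;> cases c <;> cases d <;> decide)
    have h := nf_mem_of_bin A hA 1 hF hbin (translY_mem_orbSpan A 1 _ mTTF)
    rw [nf_yS A hA 1 h1 h2 h12 hP ![false, true, true, false]] at h
    rw [ΨL_apply, e]; exact h
  · show ΨL A (Gk1 6, GCv1 6) ∈ _
    have e : ((Gk1 6, tab16 (GCv1 6)) : (Fin 4 → ℤ) × ((Fin 4 → Bool) → ℤ)) = (kT, fun η => cB ![false, true, true, false] (pT η)) :=
      Prod.ext (by decide) (funext_pat fun a b c d => by cases a <;> cases b <;> cases c <;> cases d <;> decide)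
    have h := nf_mem_of_bin A hA 1 hF hbin (translT_mem_orbSpan A 1 _ mTTF)
    rw [nf_tS A hA h1 h2 h12 hP ![false, true, true, false]] at h
    rw [ΨL_apply, e]; exact h
  · show ΨL A (Gk1 7, GCv1 7) ∈ _
    have e : ((Gk1 7, tab16 (GCv1 7)) : (Fin 4 → ℤ) × ((Fin 4 → Bool) → ℤ)) = (kTY 1, fun η => cB ![false, true, true, false] (pY 1 (pT η))) :=
      Prod.ext (by decide) (funext_pat fun a b c d => by cases a <;> cases b <;> cases c <;> cases d <;> decide)
    have h := nf_mem_of_bin A hA 1 hF hbin (translT_mem_orbSpan A 1 _ (translY_mem_orbSpan A 1 _ mTTF))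
    rw [nf_tyS A hA 1 h1 h2 h12 hP ![false, true, true, false]] at h
    rw [ΨL_apply, e]; exact h
  · show ΨL A (Gk1 8, GCv1 8) ∈ _
    have e : ((Gk1 8, tab16 (GCv1 8)) : (Fin 4 → ℤ) × ((Fin 4 → Bool) → ℤ)) = (kS, cB ![false, true, false, true]) :=
      Prod.ext (by decide) (funext_pat fun a b c d => by cases a <;> cases b <;> cases c <;> cases d <;> decide)
    have h := nf_mem_of_bin A hA 1 hF hbin mTFT
    rw [nf_S A hA h1 h2 h12 hP ![false, true, false, true]] at h
    rw [ΨL_apply, e]; exact h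
  · show ΨL A (Gk1 9, GCv1 9) ∈ _
    have e : ((Gk1 9, tab16 (GCv1 9)) : (Fin 4 → ℤ) × ((Fin 4 → Bool) → ℤ)) = (kY 1, fun η => cB ![false, true, false, true] (pY 1 η)) :=
      Prod.ext (by decide) (funext_pat fun a b c d => by cases a <;> cases b <;> cases c <;> cases d <;> decide)
    have h := nf_mem_of_bin A hA 1 hF hbin (translY_mem_orbSpan A 1 _ mTFT)
    rw [nf_yS A hA 1 h1 h2 h12 hP ![false, true, false, true]] at h
    rw [ΨL_apply, e]; exact h
  · show ΨL A (Gk1 10, GCv1 10) ∈ _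
    have e : ((Gk1 10, tab16 (GCv1 10)) : (Fin 4 → ℤ) × ((Fin 4 → Bool) → ℤ)) = (kT, fun η => cB ![false, true, false, true] (pT η)) :=
      Prod.ext (by decide) (funext_pat fun a b c d => by cases a <;> cases b <;> cases c <;> cases d <;> decide)
    have h := nf_mem_of_bin A hA 1 hF hbin (translT_mem_orbSpan A 1 _ mTFT)
    rw [nf_tS A hA h1 h2 h12 hP ![false, true, false, true]] at h
    rw [ΨL_apply, e]; exact h
  · show ΨL A (Gk1 11, GCv1 11) ∈ _
    have e : ((Gk1 11, tab16 (GCv1 11)) : (Fin 4 → ℤ) × ((Fin 4 → Bool) → ℤ)) = (kTY 1, fun η => cB ![false, true, false, true] (pY 1 (pT η))) :=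
      Prod.ext (by decide) (funext_pat fun a b c d => by cases a <;> cases b <;> cases c <;> cases d <;> decide)
    have h := nf_mem_of_bin A hA 1 hF hbin (translT_mem_orbSpan A 1 _ (translY_mem_orbSpan A 1 _ mTFT))
    rw [nf_tyS A hA 1 h1 h2 h12 hP ![false, true, false, true]] at h
    rw [ΨL_apply, e]; exact h

/-- **THE CLOSING LATTICE: the normal form of every Hodge vector lies in the value module of `B1`.** [folklore] -/
theorem nf_mem_valMod_of_hodge (hA : Odd (Fintype.card A)) (h3 : 3 ≤ Fintype.card A) (ζ : ZMod 2) (h1 : u₁ ∉ P) (h2 : u₂ ∉ P)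
    (h12 : u₁ ≠ u₂) (hP : P.card + 1 = Fintype.card A / 2) (hs₀ : s₀ ∈ insert u₁ (insert u₂ P))
    (hX : ∀ s, s + σ ∈ insert u₁ (insert u₂ P) ↔ (s ∉ insert u₁ (insert u₂ P) ∨ s = s₀)) (hw : w ∉ Q)
    (hQ : Q.card = Fintype.card A / 2) {x : Ty₄ A → ℤ} (hx : x ∈ hodge₄ A) :
    nf A x ∈ valMod A ζ ↑(famB1 A P u₁ u₂ Q w u₀) := by
  have hdec := kC_decomp (fun j => kOf A j x) (fun η => fnl A (wC A η) x) (fun η => fnl_wC_not A hA η x)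
    (rel01_lit A hA hx) (rel02_lit A hA hx) (rel03_lit A hA hx) (rel4_lit A hA hx)
  rw [nf_eq_ΦL, hdec, map_sum]
  refine Submodule.sum_mem _ fun l _ => ?_
  rw [map_smul]
  refine Submodule.smul_mem _ _ ?_
  have h01 : ∀ z : ZMod 2, z = 0 ∨ z = 1 := by decide
  rcases h01 ζ with rfl | rfl
  · rw [← ΨL_apply, B_eq_sum_G0 l, map_sum]
    refine Submodule.sum_mem _ fun i _ => ?_
    rw [map_smul]
    exact Submodule.smul_mem _ _ (ΦL_G0_mem A hA h3 h1 h2 h12 hP hs₀ hX hw hQ i)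
  · rw [← ΨL_apply, B_eq_sum_G1 l, map_sum]
    refine Submodule.sum_mem _ fun i _ => ?_
    rw [map_smul]
    exact Submodule.smul_mem _ _ (ΦL_G1_mem A hA h3 h1 h2 h12 hP hs₀ hX hw hQ i)

/-- **The value vector of every Hodge vector lies in the value module of `B1`**: `Avec x ∈ Avec (orbSpan B1)`. [folklore] -/
theorem Avec_mem_valMod_of_hodge (hA : Odd (Fintype.card A)) (h3 : 3 ≤ Fintype.card A) (ζ : ZMod 2) (h1 : u₁ ∉ P) (h2 : u₂ ∉ P)
    (h12 : u₁ ≠ u₂) (hP : P.card + 1 = Fintype.card A / 2) (hs₀ : s₀ ∈ insert u₁ (insert u₂ P))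
    (hX : ∀ s, s + σ ∈ insert u₁ (insert u₂ P) ↔ (s ∉ insert u₁ (insert u₂ P) ∨ s = s₀)) (hw : w ∉ Q)
    (hQ : Q.card = Fintype.card A / 2) {x : Ty₄ A → ℤ} (hx : x ∈ hodge₄ A) :
    Avec A x ∈ valMod A ζ ↑(famB1 A P u₁ u₂ Q w u₀) :=
  Avec_mem_of_nf_mem A hA (all_bin A hA h3 ζ h1 h2 h12 hP hs₀ hX hw hQ) hx
    (nf_mem_valMod_of_hodge A hA h3 ζ h1 h2 h12 hP hs₀ hX hw hQ hx)

end Members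

end

end Summit.HodgeConjecture.CorCM.Census.QuarticInversion
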